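import Mathlib
import Summits.Ventures.FusionMHD.Models.SAlphaStableS3A17875
import Summits.Ventures.FusionMHD.Bench.BallooningSAlphaEndMoveS3A1825
import HarnessLib

/-!
# F3 — FOURTH-ROUND HALF-GAP END MOVE AT SHEAR `s = 3` (JOINT, both cells already in the tree, BY NAME): the first-stability edge of the
# `s–α` MODEL at `s = 3` lies in `[143/80, 73/40]` (width `3/80` = HALF of `[7/4, 73/40]`, width `3/40`, ★ #343)
(venture LADDER-GRIDFUSION, rung F3; cell `gridfusion`; gridfusion-model-7 (g10), 2026-08-28.  DIRECTOR RULING 67 (3): one count per halving per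
shear; LOWER cell = gridfusion-lit-4 (g13)'s `SAlphaStableS3A17875.stableSide : SAlpha.StableSide (3) (143/80)` (Sturm/Taylor-model core + tail,
landed 2026-08-28 for this pairing, INBOX I4387); UPPER cell = gridfusion-model-7 (g10)'s third-round spline witness
`Bench/BallooningSAlphaEndMoveS3A1825` — `SAlphaS3W1825.unstableWitness_band : ∀ α ∈ Icc (73/40) (19/10), UnstableWitness (3) α (−32) 32 X X′`
(lit-3's finite-element lane), whose left end is `73/40`.  THIS file only CONJOINS the two (0 `decide`, 0 kit, no `native_decide`).)

## THREE COLUMNS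
CERTIFIED: in the `s–α` ballooning MODEL (Freidberg (12.96)–(12.99), `θ₀ = 0`) at shear `s = 3`: `143/80 ∉ U_{3}` and `73/40 ∈ U_{3}`
(`U_s` = the `α` at which some compact window carries a `C¹` trial function of negative one-surface energy) ⇒ `inf {α ≥ 143/80 : α ∈ U_{3}} ∈ [143/80, 73/40]`
CLOSED, width `3/80`.  Monotonicity / continuity of the edge in `α` NOT typed.  VALIDATED (not in the kernel): float E–L shooting edge `α ≈ 1.815 (1.810)`
(lit-4 kit j299948 / lit-3 `edges.py`).  MODELLED: `s–α` model (large-aspect-ratio shifted circles, high-`n` ballooning ordering, `θ₀ = 0`, ideal MHD);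
no device, no `β`-limit.  Citations: Freidberg 2014 §12.3 (12.38)–(12.40), §12.6.2 (12.96)–(12.100) [Freidberg2014].
-/

open Literature.MathematicalPhysics.MHD.Ballooning Literature.MathematicalPhysics.MHD.Ballooning.SAlpha
open Set

namespace Summit.Ventures.FusionMHD.Bench.SAlphaEndMoveS3R4

/-- ★★★ THE FOURTH-ROUND HALF-GAP END MOVE AT `s = 3`: `143/80` is on the STABLE side (gridfusion-lit-4's `SAlphaStableS3A17875.stableSide`, BY NAME)
and `73/40` is NOT (gridfusion-model-7's `SAlphaS3W1825.unstableWitness_band`, BY NAME) — the first-stability edge of the MODEL at `s = 3` lies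
in the closed interval `[143/80, 73/40]` of width `3/80`. [cite: Freidberg2014, §12.3 eqs. (12.38)–(12.40)] -/
theorem endMove_three_fourth : StableSide (3) (143/80) ∧ ¬ StableSide (3) (73/40) :=
  ⟨Summit.Ventures.FusionMHD.Models.SAlphaStableS3A17875.stableSide,
   Summit.Ventures.FusionMHD.Bench.SAlphaS3W1825.not_stableSide_of_mem_band ⟨le_rfl, by norm_num⟩⟩

/-- The same bracket as a membership statement for the UPPER end: some window carries a witness at `(3, 73/40)`.
[cite: Freidberg2014, §12.3 eqs. (12.38)–(12.40)] -/
theorem exists_unstableWitness_upper : ∃ a b : ℝ, ∃ X X' : ℝ → ℝ, UnstableWitness (3) (73/40) a b X X' :=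
  Summit.Ventures.FusionMHD.Bench.SAlphaS3W1825.exists_unstableWitness_of_mem_band ⟨le_rfl, by norm_num⟩

end Summit.Ventures.FusionMHD.Bench.SAlphaEndMoveS3R4
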